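import Summits.RiemannHypothesis.RiemannHypothesis.Theses.WeilComb
import Summits.RiemannHypothesis.RiemannHypothesis.Theorems.WeilCombCombShapeAdmissible
import Literature.NumberTheory.LFunctions.WeilExplicit
import Literature.NumberTheory.LFunctions.WeilMellinBounds
import Literature.NumberTheory.LFunctions.WeilArchimedeanPositivityProofs

/-!
# Exact polar term of the fixed-shape comb autocorrelation
(crux `WeilComb.CombShapePositivity`, item stmt-RiemannHypothesis-11229, line `Sketch`; sub-goal
`weilPolarTerm_comb_re` of the Theorem-B stub `stub_window`, the exact finite-dimensional bookkeeping of the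
polar term of `Q(g) = W(g ⋆ g̃) = P − Pr + A`)

Notation: `φ₀(u) = expNegInvGlue (1 - u²)` (the route's fixed bump, a Weil test by
`weilComb_shapeBump_isWeilTest`), `φ_ε(t) = ε⁻¹ φ₀(t/ε)`, comb `g(x) = Σ_{1 ≤ m ≤ M} a_m φ_ε(x − log m)`,
`k = g ⋆ g̃` (`weilConv g (weilReflect g)`), `ĥ = weilMellin h`.

**Statement.** For `ε > 0`,
`Re (k̂(0) + k̂(1)) = 2 Re (φ̂_ε(0) conj φ̂_ε(1) · A₋ conj A₊)`, `A₋ = Σ a_m m^{-1/2}`, `A₊ = Σ a_m m^{1/2}`: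
the polar term of the comb autocorrelation is an explicit rank-2 Hermitian form in the coefficients `a`.

**Proof.** `k̂(0) + k̂(1) = 2 Re(ĝ(0) conj ĝ(1))` (`weilPolarTerm_weilConv_weilReflect`, the comb being a Weil
test). By linearity of the transform over the finite sum and the translation rule
`(τ_x h)^(s) = e^{(s − 1/2) x} ĥ(s)` (`weilMellin_weilTranslate`), `ĝ(s) = (Σ_m a_m e^{(s − 1/2) log m}) φ̂_ε(s)`;
at `s = 0` the Dirichlet factor is `Σ a_m (√m)⁻¹ = A₋` and at `s = 1` it is `Σ a_m √m = A₊`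
(`e^{(log m)/2} = √m` for `m ≥ 1`). Hence `ĝ(0) conj ĝ(1) = φ̂_ε(0) conj φ̂_ε(1) · A₋ conj A₊`.
-/

noncomputable section

-- the sub-problem path RiemannHypothesis/RiemannHypothesis duplicates a namespace (D-0017)
set_option linter.dupNamespace false

open scoped BigOperators ComplexConjugate
open Complex MeasureTheory Set

namespace Summit.RiemannHypothesis.RiemannHypothesis.Theorems.WeilCombBohrFejer

open Literature.NumberTheory.LFunctions

/-! ### Private toolkit: the dilate `φ_ε`, the comb and its transform -/

/-- `φ_ε = ε⁻¹ φ(·/ε)` is a Weil test function for `ε ≠ 0` (smoothness of `t ↦ t/ε`; the support is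
the image of a compact set under the homeomorphism `t ↦ ε t`). [folklore] -/
private theorem isWeilTest_dil_polarExact {φ : ℝ → ℂ} {ε : ℝ} (hφ : IsWeilTest φ) (hε : ε ≠ 0) :
    IsWeilTest (fun t : ℝ => (ε : ℂ)⁻¹ * φ (t / ε)) := by
  -- adapted from `WeilCombBohrFejer.isWeilTest_dil` (private in the Gram-identity file)
  have h1 : IsWeilTest (fun t : ℝ => φ (t / ε)) := by
    refine ⟨hφ.1.comp (contDiff_id.div_const ε), ?_⟩
    have e : (fun t : ℝ => φ (t / ε)) = φ ∘ (Homeomorph.mulRight₀ ε⁻¹ (inv_ne_zero hε)) := by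
      ext t
      simp [div_eq_mul_inv]
    rw [e]
    exact hφ.2.comp_homeomorph _
  exact h1.const_mul _

/-- Every comb `x ↦ Σ_{m ≤ M} a m · ε⁻¹ φ((x − log m)/ε)` built on a Weil test `φ` (`ε ≠ 0`) is a
Weil test: smooth as a finite sum of smooth functions of affine maps, compactly supported as a
finite sum of compactly supported functions composed with affine homeomorphisms. [folklore] -/
private theorem isWeilTest_comb_polarExact {φ : ℝ → ℂ} (hφ : IsWeilTest φ) {ε : ℝ} (hε : ε ≠ 0)
    (M : ℕ) (a : ℕ → ℂ) :
    IsWeilTest (fun x : ℝ => ∑ m ∈ Finset.Icc 1 M,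
      a m * ((ε : ℂ)⁻¹ * φ ((x - Real.log (m : ℝ)) / ε))) := by
  -- adapted from `Theorems.weilComb_isWeilTest_comb` (CombSubcritical load-bearing file)
  refine ⟨?_, ?_⟩
  · refine ContDiff.sum fun m _ => ?_
    refine contDiff_const.mul (contDiff_const.mul ?_)
    exact hφ.1.comp ((contDiff_id.sub contDiff_const).div_const ε)
  · have h1 : (fun x : ℝ => ∑ m ∈ Finset.Icc 1 M,
          a m * ((ε : ℂ)⁻¹ * φ ((x - Real.log (m : ℝ)) / ε))) =
        ∑ m ∈ Finset.Icc 1 M, fun x : ℝ => a m * ((ε : ℂ)⁻¹ * φ ((x - Real.log (m : ℝ)) / ε)) := by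
      ext x
      simp [Finset.sum_apply]
    rw [h1]
    refine HasCompactSupport.finset_sum fun m _ => ?_
    have h2 : HasCompactSupport fun x : ℝ => φ ((x - Real.log (m : ℝ)) / ε) := by
      have h := hφ.2.comp_homeomorph
        (affineHomeomorph ε⁻¹ (-(Real.log (m : ℝ)) / ε) (inv_ne_zero hε))
      convert h using 1
      funext x
      simp only [Function.comp_apply, affineHomeomorph_apply]
      congr 1
      ring
    exact (h2.mul_left).mul_left

/-- Transform of the comb: `ĝ(s) = (Σ_m a_m e^{(s − 1/2) log m}) φ̂_ε(s)` (linearity over the finite sum,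
`integral_finsetSum`, and the translation rule `weilMellin_weilTranslate`). [folklore] -/
private theorem weilMellin_comb_polarExact {φ : ℝ → ℂ} (hφ : IsWeilTest φ) {ε : ℝ} (hε : ε ≠ 0)
    (M : ℕ) (a : ℕ → ℂ) (s : ℂ) :
    weilMellin (fun x : ℝ => ∑ m ∈ Finset.Icc 1 M,
        a m * ((ε : ℂ)⁻¹ * φ ((x - Real.log (m : ℝ)) / ε))) s =
      (∑ m ∈ Finset.Icc 1 M, a m * cexp ((s - 1 / 2) * (Real.log (m : ℝ) : ℂ))) *
        weilMellin (fun t : ℝ => (ε : ℂ)⁻¹ * φ (t / ε)) s := by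
  -- adapted from `WeilCombSubcritical.weilMellin_comb_polar` (private in the `stub_polar` file)
  set φε : ℝ → ℂ := fun t : ℝ => (ε : ℂ)⁻¹ * φ (t / ε) with hφε
  have hW : IsWeilTest φε := isWeilTest_dil_polarExact hφ hε
  have hint : ∀ m ∈ Finset.Icc 1 M, Integrable (fun t : ℝ =>
      a m * (weilTranslate φε (Real.log (m : ℝ)) t * cexp ((s - 1 / 2) * t))) := by
    intro m _
    have hT : IsWeilTest (weilTranslate φε (Real.log (m : ℝ))) := hW.weilTranslate _
    exact (integrable_weilIntegrand hT.1.continuous hT.2 s).const_mul (a m)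
  calc weilMellin (fun x : ℝ => ∑ m ∈ Finset.Icc 1 M,
          a m * ((ε : ℂ)⁻¹ * φ ((x - Real.log (m : ℝ)) / ε))) s
      = ∫ t : ℝ, ∑ m ∈ Finset.Icc 1 M,
          a m * (weilTranslate φε (Real.log (m : ℝ)) t * cexp ((s - 1 / 2) * t)) := by
        unfold weilMellin
        congr 1 with t
        rw [Finset.sum_mul]
        refine Finset.sum_congr rfl fun m _ => ?_
        simp only [weilTranslate, hφε]
        ring
    _ = ∑ m ∈ Finset.Icc 1 M, ∫ t : ℝ,
          a m * (weilTranslate φε (Real.log (m : ℝ)) t * cexp ((s - 1 / 2) * t)) :=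
        integral_finsetSum _ hint
    _ = ∑ m ∈ Finset.Icc 1 M,
          a m * (cexp ((s - 1 / 2) * (Real.log (m : ℝ) : ℂ)) * weilMellin φε s) := by
        refine Finset.sum_congr rfl fun m _ => ?_
        rw [integral_const_mul, ← weilMellin_weilTranslate]
        rfl
    _ = (∑ m ∈ Finset.Icc 1 M, a m * cexp ((s - 1 / 2) * (Real.log (m : ℝ) : ℂ))) *
          weilMellin φε s := by
        rw [Finset.sum_mul]
        refine Finset.sum_congr rfl fun m _ => ?_
        ring

/-- `e^{(log x)/2} = √x` for `x > 0`. [folklore] -/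
private theorem exp_log_half_polarExact {x : ℝ} (hx : 0 < x) :
    Real.exp (Real.log x / 2) = Real.sqrt x := by
  rw [Real.sqrt_eq_rpow, Real.rpow_def_of_pos hx]
  congr 1
  ring

/-- The Dirichlet factor at `s = 0`: `Σ a_m e^{-(log m)/2} = Σ a_m (√m)⁻¹` (`m ≥ 1`). [folklore] -/
private theorem dirichlet_zero_polarExact (M : ℕ) (a : ℕ → ℂ) :
    ∑ m ∈ Finset.Icc 1 M, a m * cexp (((0 : ℂ) - 1 / 2) * (Real.log (m : ℝ) : ℂ)) =
      ∑ m ∈ Finset.Icc 1 M, a m * ((Real.sqrt (m : ℝ) : ℝ) : ℂ)⁻¹ := by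
  refine Finset.sum_congr rfl fun m hm => ?_
  have hm0 : (0 : ℝ) < m := by
    have h1 : (1 : ℝ) ≤ m := by exact_mod_cast (Finset.mem_Icc.1 hm).1
    linarith
  have e : ((0 : ℂ) - 1 / 2) * (Real.log (m : ℝ) : ℂ) = ((-(Real.log (m : ℝ) / 2) : ℝ) : ℂ) := by
    push_cast
    ring
  rw [e, ← Complex.ofReal_exp, Real.exp_neg, exp_log_half_polarExact hm0, Complex.ofReal_inv]

/-- The Dirichlet factor at `s = 1`: `Σ a_m e^{(log m)/2} = Σ a_m √m` (`m ≥ 1`). [folklore] -/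
private theorem dirichlet_one_polarExact (M : ℕ) (a : ℕ → ℂ) :
    ∑ m ∈ Finset.Icc 1 M, a m * cexp (((1 : ℂ) - 1 / 2) * (Real.log (m : ℝ) : ℂ)) =
      ∑ m ∈ Finset.Icc 1 M, a m * ((Real.sqrt (m : ℝ) : ℝ) : ℂ) := by
  refine Finset.sum_congr rfl fun m hm => ?_
  have hm0 : (0 : ℝ) < m := by
    have h1 : (1 : ℝ) ≤ m := by exact_mod_cast (Finset.mem_Icc.1 hm).1
    linarith
  have e : ((1 : ℂ) - 1 / 2) * (Real.log (m : ℝ) : ℂ) = ((Real.log (m : ℝ) / 2 : ℝ) : ℂ) := by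
    push_cast
    ring
  rw [e, ← Complex.ofReal_exp, exp_log_half_polarExact hm0]

/-- The fixed-shape comb is a Weil test (`ε ≠ 0`). [folklore] -/
private theorem isWeilTest_shapeComb_polarExact {ε : ℝ} (hε : ε ≠ 0) (M : ℕ) (a : ℕ → ℂ) :
    IsWeilTest (fun x : ℝ => ∑ m ∈ Finset.Icc 1 M,
      a m * ((ε : ℂ)⁻¹ * ((expNegInvGlue (1 - ((x - Real.log (m : ℝ)) / ε) ^ 2) : ℝ) : ℂ))) :=
  isWeilTest_comb_polarExact (φ := fun u : ℝ => ((expNegInvGlue (1 - u ^ 2) : ℝ) : ℂ))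
    Summit.RiemannHypothesis.RiemannHypothesis.Theorems.weilComb_shapeBump_isWeilTest hε M a

/-- Transform of the fixed-shape comb: `ĝ(s) = (Σ_m a_m e^{(s − 1/2) log m}) φ̂_ε(s)`. [folklore] -/
private theorem weilMellin_shapeComb_polarExact {ε : ℝ} (hε : ε ≠ 0) (M : ℕ) (a : ℕ → ℂ) (s : ℂ) :
    weilMellin (fun x : ℝ => ∑ m ∈ Finset.Icc 1 M,
        a m * ((ε : ℂ)⁻¹ * ((expNegInvGlue (1 - ((x - Real.log (m : ℝ)) / ε) ^ 2) : ℝ) : ℂ))) s =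
      (∑ m ∈ Finset.Icc 1 M, a m * cexp ((s - 1 / 2) * (Real.log (m : ℝ) : ℂ))) *
        weilMellin (fun t : ℝ => (ε : ℂ)⁻¹ * ((expNegInvGlue (1 - (t / ε) ^ 2) : ℝ) : ℂ)) s :=
  weilMellin_comb_polarExact (φ := fun u : ℝ => ((expNegInvGlue (1 - u ^ 2) : ℝ) : ℂ))
    Summit.RiemannHypothesis.RiemannHypothesis.Theorems.weilComb_shapeBump_isWeilTest hε M a s

/-- Bookkeeping inside `re`: `2 Re (A P (B Q)) = 2 Re (P Q (A B))`. [folklore] -/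
private theorem two_mul_re_perm_polarExact (A B P Q : ℂ) :
    2 * (A * P * (B * Q)).re = 2 * (P * Q * (A * B)).re := by
  rw [show A * P * (B * Q) = P * Q * (A * B) by ring]

/-! ### The sub-goal -/

/-- **Exact polar term of the fixed-shape comb autocorrelation** (sub-goal (a) of `stub_window`, line
`Sketch`). For `ε > 0`, `k = g ⋆ g̃` with `g(x) = Σ_{m ≤ M} a_m φ_ε(x − log m)`:
`Re (k̂(0) + k̂(1)) = 2 Re (φ̂_ε(0) conj φ̂_ε(1) · (Σ a_m m^{-1/2}) conj (Σ a_m m^{1/2}))` — a rank-2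
Hermitian form in `a` (`k̂(0) + k̂(1) = 2 Re(ĝ(0) conj ĝ(1))`, `ĝ(s) = φ̂_ε(s) Σ a_m m^{s − 1/2}`).
[folklore] -/
theorem weilPolarTerm_comb_re : ∀ ε : ℝ, 0 < ε → ∀ (M : ℕ) (a : ℕ → ℂ),
    (weilPolarTerm
      (weilConv (fun x : ℝ => ∑ m ∈ Finset.Icc 1 M,
          a m * ((ε : ℂ)⁻¹ * ((expNegInvGlue (1 - ((x - Real.log (m : ℝ)) / ε) ^ 2) : ℝ) : ℂ)))
        (weilReflect (fun x : ℝ => ∑ m ∈ Finset.Icc 1 M,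
          a m * ((ε : ℂ)⁻¹ * ((expNegInvGlue (1 - ((x - Real.log (m : ℝ)) / ε) ^ 2) : ℝ) : ℂ)))))).re =
      2 * (weilMellin (fun t : ℝ => (ε : ℂ)⁻¹ * ((expNegInvGlue (1 - (t / ε) ^ 2) : ℝ) : ℂ)) 0 *
            conj (weilMellin (fun t : ℝ => (ε : ℂ)⁻¹ * ((expNegInvGlue (1 - (t / ε) ^ 2) : ℝ) : ℂ)) 1) *
          ((∑ m ∈ Finset.Icc 1 M, a m * ((Real.sqrt (m : ℝ) : ℝ) : ℂ)⁻¹) *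
            conj (∑ m ∈ Finset.Icc 1 M, a m * ((Real.sqrt (m : ℝ) : ℝ) : ℂ)))).re := by
  intro ε hε M a
  rw [weilPolarTerm_weilConv_weilReflect (isWeilTest_shapeComb_polarExact hε.ne' M a),
    Complex.ofReal_re, weilMellin_shapeComb_polarExact hε.ne' M a 0,
    weilMellin_shapeComb_polarExact hε.ne' M a 1, dirichlet_zero_polarExact,
    dirichlet_one_polarExact, map_mul (starRingEnd ℂ)]
  exact two_mul_re_perm_polarExact _ _ _ _

end Summit.RiemannHypothesis.RiemannHypothesis.Theorems.WeilCombBohrFejer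

end
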